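import Summits.SmoothPoincare4.SmoothPoincare4.Theorems.CongruenceShadowsGriffithsHandlebodyExtensionCoverCharts
import HarnessLib

/-!
# SmoothPoincare4 / CongruenceShadows — `GriffithsHandlebodyExtension` (item stmt-SmoothPoincare4-15190): the homothety-cover core, IV — the equivariant diffeomorphism `Ψ̂`

Support file (`--supports` stmt-SmoothPoincare4-15190) of the homothety-cover proof of the genus-one
clause (E) of Griffiths' handlebody extension theorem — *every self-diffeomorphism of the Heegaard torus
`∂V` of the round solid torus fixing the base point and acting trivially on `π₁(∂V)` extends to a
self-diffeomorphism of `V`* (hypothesis `hE` of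
`Literature.Topology.FourManifolds.RoundSolidTorusModel.diffeoExtends_of_map_ker_eq_ker_of_forall_diffeoExtends`).
See the module docstring of `…CoverDefs` for the whole line (E1–E6) and the notation
(`τ̂`, `δ_λ`, `ρ`, `χ`, `f`, `Δ^(c)`, `α`, `L`, `M`, `Ψ̂`, `ẽ_c`).

This part: the rescaling chart `M (c, u) = (c, c ẽ_c u)` and the composite `Ψ̂ = L ∘ M ∘ α⁻¹` with its inverse
`Ψ̂' = α ∘ M' ∘ L⁻¹`: `Ψ̂` maps the punctured closed upper half-space to itself, restricts to `τ̂` on the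
boundary plane, commutes with all powers of the deck homothety and is a local diffeomorphism; summary `CoreData.core`.
-/

-- the registered namespace `Summit.SmoothPoincare4.SmoothPoincare4.Theorems` repeats a component
set_option linter.dupNamespace false

noncomputable section

namespace Summit.SmoothPoincare4.SmoothPoincare4.Theorems

namespace HomothetyCover

open Set Function Metric Filter
open scoped Topology ContDiff

namespace CoreData

variable (D : CoreData)

/-- `M' ∘ M = id` on `(0, ∞) × {‖u‖ < R₁}`. -/
theorem M'_M {c : ℝ} (hc : 0 < c) {u : E2} (hu : ‖u‖ < D.R₁) : D.M' (D.M (c, u)) = (c, u) := by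
  simp [M, M', smul_smul, inv_mul_cancel₀ hc.ne', D.e'_e c hc u hu]

/-- `M` is smooth on `(0, ∞) × {‖u‖ < R₁}`. -/
theorem contDiffAt_M {c : ℝ} (hc : 0 < c) {u : E2} (hu : ‖u‖ < D.R₁) :
    ContDiffAt ℝ ∞ D.M (c, u) :=
  contDiffAt_fst.prodMk (contDiffAt_fst.smul (D.contDiffAt_e c hc u hu))

/-- `M'` is smooth at the points of `M((0, ∞) × {‖u‖ < R₁})`. -/
theorem contDiffAt_M' {c : ℝ} (hc : 0 < c) {u : E2} (hu : ‖u‖ < D.R₁) :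
    ContDiffAt ℝ ∞ D.M' (D.M (c, u)) := by
  have hM : D.M (c, u) = (c, c • D.e c u) := rfl
  rw [hM]
  have h1 : ContDiffAt ℝ ∞ (fun x : ℝ × E2 => (x.1, x.1⁻¹ • x.2)) (c, c • D.e c u) :=
    contDiffAt_fst.prodMk ((contDiffAt_fst.inv hc.ne').smul contDiffAt_snd)
  have h2 : ContDiffAt ℝ ∞ (uncurry D.e') (c, D.e c u) := D.contDiffAt_e' c hc u hu
  have heq : (fun x : ℝ × E2 => (x.1, x.1⁻¹ • x.2)) (c, c • D.e c u) = (c, D.e c u) := by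
    simp [smul_smul, inv_mul_cancel₀ hc.ne']
  have h3 := h2.comp_contDiffWithinAt_of_eq (c, c • D.e c u) (h1.contDiffWithinAt (s := Set.univ)) heq
  rw [contDiffWithinAt_univ] at h3
  exact contDiffAt_fst.prodMk h3

/-! ### The extension `Ψ̂ = L ∘ M ∘ α⁻¹` and its inverse -/

/-- The explicit formula for `Ψ̂`. -/
theorem Ψ_apply (p : E2 × ℝ) : D.Ψ p =
    (rad p • D.e (rad p) ((rad p + p.2)⁻¹ • p.1),
      D.f (rad p) (rad p • D.e (rad p) ((rad p + p.2)⁻¹ • p.1))) := rfl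

/-- `ẽ_c` maps the closed unit disc into `{w = 0} ∪ {ρ (c • w) ≤ c}` (the image hypothesis). -/
theorem e_mem {c : ℝ} (hc : 0 < c) {u : E2} (hu : ‖u‖ ≤ 1) :
    D.e c u = 0 ∨ ‖D.τ' (c • D.e c u)‖ ≤ c := by
  have : D.e c u ∈ D.e c '' closedBall (0 : E2) 1 := mem_image_of_mem _ (mem_closedBall_zero_iff.2 hu)
  rw [D.e_image c hc] at this
  exact this

/-- `Ψ̂` maps `H³ ∖ 0` into itself. -/
theorem Ψ_mem {p : E2 × ℝ} (hp : p ∈ Hpunct) : D.Ψ p ∈ Hpunct := by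
  have hr := rad_pos hp.2
  have hu := norm_αinv_snd_le_one hp
  rw [Ψ_apply]
  set r := rad p
  set u := (rad p + p.2)⁻¹ • p.1
  have hmem := D.e_mem hr hu
  by_cases hW : D.e r u = 0
  · rw [hW, smul_zero, D.f_zero_right]
    exact ⟨hr.le, fun h => hr.ne' (congrArg Prod.snd h)⟩
  · have hW' : r • D.e r u ≠ 0 := smul_ne_zero hr.ne' hW
    refine ⟨?_, fun h => hW' (congrArg Prod.fst h)⟩
    rcases hmem with h0 | hle
    · exact absurd h0 hW
    · exact (D.f_nonneg_iff hr _).2 hle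

/-- On the boundary plane `Ψ̂` is `τ̂`. -/
theorem Ψ_boundary {y : E2} (hy : y ≠ 0) : D.Ψ (y, 0) = (D.τ y, 0) := by
  have hny : 0 < ‖y‖ := norm_pos_iff.2 hy
  have hr : rad (y, 0) = ‖y‖ := by simp [rad, Real.sqrt_sq (norm_nonneg _)]
  have hu : ‖(‖y‖ + 0)⁻¹ • y‖ = 1 := by
    rw [add_zero, norm_smul, norm_inv, norm_norm, inv_mul_cancel₀ hny.ne']
  rw [Ψ_apply]
  simp only [hr]
  rw [D.e_sphere _ hny _ hu, smul_smul, add_zero, mul_inv_cancel₀ hny.ne', one_smul, smul_smul,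
    mul_inv_cancel₀ hny.ne', one_smul]
  refine Prod.ext rfl ?_
  show D.f ‖y‖ (D.τ y) = 0
  exact D.f_eq_zero_of_ρ_eq hny (D.ρ_τ y)

/-- `Ψ̂` commutes with the deck homothety. -/
theorem Ψ_smul {p : E2 × ℝ} (hp : p ∈ Hpunct) : D.Ψ (D.lam • p) = D.lam • D.Ψ p := by
  have hr := rad_pos hp.2
  have h := rad_add_snd_pos hp
  have hu1 := norm_αinv_snd_le_one hp
  have hu : ‖(αinv p).2‖ < D.R₁ := lt_of_le_of_lt hu1 D.one_lt_R₁
  show D.L (D.M (αinv (D.lam • p))) = D.lam • D.L (D.M (αinv p))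
  rw [αinv_smul D.lam_pos h]
  have hper := D.e_per (rad p) hr (αinv p).2 hu
  have h1 : (αinv p).1 = rad p := rfl
  simp only [L, M, h1, hper, Prod.smul_mk, smul_eq_mul]
  rw [mul_smul, D.f_smul]

/-- `Ψ̂` is smooth at every point of `H³ ∖ 0` (as a map of `ℝ² × ℝ`). -/
theorem contDiffAt_Ψ {p : E2 × ℝ} (hp : p ∈ Hpunct) : ContDiffAt ℝ ∞ D.Ψ p := by
  have hr := rad_pos hp.2
  have h := rad_add_snd_pos hp
  have hu : ‖(αinv p).2‖ < D.R₁ := lt_of_le_of_lt (norm_αinv_snd_le_one hp) D.one_lt_R₁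
  have h1 : ContDiffAt ℝ ∞ αinv p := contDiffAt_αinv hp.2 h
  have h2 : ContDiffAt ℝ ∞ D.M (αinv p) := D.contDiffAt_M hr hu
  have h3 : ContDiffAt ℝ ∞ D.L (D.M (αinv p)) := D.contDiffAt_L (show 0 < rad p from hr)
  have h4 := h3.comp_contDiffWithinAt_of_eq p ((h2.comp p h1).contDiffWithinAt (s := Set.univ)) rfl
  rw [contDiffWithinAt_univ] at h4
  exact h4

/-- `Ψ̂' ∘ Ψ̂ = id` on `H³ ∖ 0`. -/
theorem Ψ'_Ψ {p : E2 × ℝ} (hp : p ∈ Hpunct) : D.Ψ' (D.Ψ p) = p := by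
  have hr := rad_pos hp.2
  have h := rad_add_snd_pos hp
  have hu : ‖(αinv p).2‖ < D.R₁ := lt_of_le_of_lt (norm_αinv_snd_le_one hp) D.one_lt_R₁
  show α (D.M' (D.Linv (D.L (D.M (αinv p))))) = p
  rw [D.Linv_L (show 0 < rad p from hr)]
  change α (D.M' (D.M (rad p, (αinv p).2))) = p
  rw [D.M'_M hr hu]
  exact α_αinv h

/-- `Ψ̂` maps `H³ ∖ 0` onto itself. -/
theorem exists_Ψ_eq {q : E2 × ℝ} (hq : q ∈ Hpunct) : ∃ p ∈ Hpunct, D.Ψ p = q := by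
  obtain ⟨W, s⟩ := q
  have hs : 0 ≤ s := hq.1
  -- choose the leaf parameter `c` with `f c W = s` and `ρ W ≤ c`
  obtain ⟨c, hc, hcW, hfc⟩ : ∃ c, 0 < c ∧ (W = 0 ∨ ‖D.τ' (c • (c⁻¹ • W))‖ ≤ c) ∧ D.f c W = s := by
    by_cases hW : W = 0
    · subst hW
      have hs' : 0 < s := by
        rcases lt_or_eq_of_le hs with h | h
        · exact h
        · exfalso; exact hq.2 (by rw [← h]; rfl)
      exact ⟨s, hs', Or.inl rfl, by simp⟩
    · obtain ⟨c, hρc, hfc⟩ := D.exists_f_eq hW hs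
      have hc : 0 < c := lt_of_lt_of_le (D.ρ_pos hW) hρc
      refine ⟨c, hc, Or.inr ?_, hfc⟩
      rw [smul_smul, mul_inv_cancel₀ hc.ne', one_smul]
      exact hρc
  -- `c⁻¹ • W` lies in `ẽ_c(D̄)`
  have hmem : c⁻¹ • W ∈ D.e c '' closedBall (0 : E2) 1 := by
    rw [D.e_image c hc]
    rcases hcW with h0 | hle
    · exact Or.inl (by simp [h0])
    · exact Or.inr hle
  obtain ⟨u, hu, hcu⟩ := hmem
  rw [mem_closedBall_zero_iff] at hu
  refine ⟨α (c, u), α_mem_Hpunct hc hu, ?_⟩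
  show D.L (D.M (αinv (α (c, u)))) = (W, s)
  rw [αinv_α hc]
  simp only [L, M, hcu, smul_smul, mul_inv_cancel₀ hc.ne', one_smul, hfc]

/-- `Ψ̂ ∘ Ψ̂' = id` on `H³ ∖ 0`. -/
theorem Ψ_Ψ' {q : E2 × ℝ} (hq : q ∈ Hpunct) : D.Ψ (D.Ψ' q) = q := by
  obtain ⟨p, hp, rfl⟩ := D.exists_Ψ_eq hq
  rw [D.Ψ'_Ψ hp]

/-- `Ψ̂'` maps `H³ ∖ 0` into itself. -/
theorem Ψ'_mem {q : E2 × ℝ} (hq : q ∈ Hpunct) : D.Ψ' q ∈ Hpunct := by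
  obtain ⟨p, hp, rfl⟩ := D.exists_Ψ_eq hq
  rwa [D.Ψ'_Ψ hp]

/-- `Ψ̂'` is smooth at every point of `H³ ∖ 0`. -/
theorem contDiffAt_Ψ' {q : E2 × ℝ} (hq : q ∈ Hpunct) : ContDiffAt ℝ ∞ D.Ψ' q := by
  obtain ⟨p, hp, rfl⟩ := D.exists_Ψ_eq hq
  have hr := rad_pos hp.2
  have hu : ‖(αinv p).2‖ < D.R₁ := lt_of_le_of_lt (norm_αinv_snd_le_one hp) D.one_lt_R₁
  have hxU : D.M (αinv p) ∈ U := (show 0 < rad p from hr)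
  have h1 : ContDiffAt ℝ ∞ D.Linv (D.L (D.M (αinv p))) := D.contDiffAt_Linv hxU
  have h2 : ContDiffAt ℝ ∞ D.M' (D.Linv (D.L (D.M (αinv p)))) := by
    rw [D.Linv_L hxU]
    exact D.contDiffAt_M' hr hu
  exact contDiff_α.contDiffAt.comp _ (h2.comp _ h1)

/-- `Ψ̂` commutes with the inverse homothety. -/
theorem Ψ_inv_smul {p : E2 × ℝ} (hp : p ∈ Hpunct) : D.Ψ (D.lam⁻¹ • p) = D.lam⁻¹ • D.Ψ p := by
  have hp' : D.lam⁻¹ • p ∈ Hpunct := smul_mem_Hpunct (inv_pos.2 D.lam_pos) hp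
  have h := D.Ψ_smul hp'
  rw [smul_smul, mul_inv_cancel₀ D.lam_ne_zero, one_smul] at h
  rw [h, smul_smul, inv_mul_cancel₀ D.lam_ne_zero, one_smul]

/-- `Ψ̂` commutes with all deck transformations `δ_λ^n`, `n ∈ ℤ`. -/
theorem Ψ_zpow_smul (n : ℤ) {p : E2 × ℝ} (hp : p ∈ Hpunct) :
    D.Ψ (D.lam ^ n • p) = D.lam ^ n • D.Ψ p := by
  induction n generalizing p with
  | zero => simp
  | succ n ih =>
    rw [zpow_add_one₀ D.lam_ne_zero, mul_smul, mul_smul, ih (smul_mem_Hpunct D.lam_pos hp),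
      D.Ψ_smul hp]
  | pred n ih =>
    rw [zpow_sub_one₀ D.lam_ne_zero, mul_smul, mul_smul,
      ih (smul_mem_Hpunct (inv_pos.2 D.lam_pos) hp), D.Ψ_inv_smul hp]

/-- `Ψ̂'` commutes with all deck transformations `δ_λ^n`, `n ∈ ℤ`. -/
theorem Ψ'_zpow_smul (n : ℤ) {q : E2 × ℝ} (hq : q ∈ Hpunct) :
    D.Ψ' (D.lam ^ n • q) = D.lam ^ n • D.Ψ' q := by
  obtain ⟨p, hp, rfl⟩ := D.exists_Ψ_eq hq
  rw [← D.Ψ_zpow_smul n hp, D.Ψ'_Ψ hp, D.Ψ'_Ψ (smul_mem_Hpunct (zpow_pos D.lam_pos n) hp)]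

/-- **The homothety-cover core.**  From the data `D` (a `δ_λ`-equivariant planar diffeomorphism
`τ̂` off the origin and a log-periodic smooth family of planar embeddings `ẽ_c` with
`ẽ_c = δ_c⁻¹ τ̂ δ_c` on the unit circle and `ẽ_c(D̄) = δ_c⁻¹ τ̂ (D̄)`) one gets a self-map `Ψ̂` of
`ℝ² × ℝ` which is a bijection of the punctured closed half-space `H³ ∖ 0` with inverse `Ψ̂'`,
both smooth near `H³ ∖ 0`, commuting with the homothety `p ↦ λ p`, and restricting to `τ̂` on the
boundary plane.  (Descending along the covering `H³ ∖ 0 → V` this is an extension of the boundary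
diffeomorphism over the solid torus.) -/
theorem core : ∃ Ψ Ψ' : E2 × ℝ → E2 × ℝ,
    (∀ p ∈ Hpunct, Ψ p ∈ Hpunct) ∧ (∀ p ∈ Hpunct, Ψ' p ∈ Hpunct) ∧
    (∀ p ∈ Hpunct, Ψ' (Ψ p) = p) ∧ (∀ p ∈ Hpunct, Ψ (Ψ' p) = p) ∧
    (∀ p ∈ Hpunct, ContDiffAt ℝ ∞ Ψ p) ∧ (∀ p ∈ Hpunct, ContDiffAt ℝ ∞ Ψ' p) ∧
    (∀ p ∈ Hpunct, Ψ (D.lam • p) = D.lam • Ψ p) ∧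
    (∀ y : E2, y ≠ 0 → Ψ (y, 0) = (D.τ y, 0)) :=
  ⟨D.Ψ, D.Ψ', fun _ hp => D.Ψ_mem hp, fun _ hq => D.Ψ'_mem hq, fun _ hp => D.Ψ'_Ψ hp,
    fun _ hq => D.Ψ_Ψ' hq, fun _ hp => D.contDiffAt_Ψ hp, fun _ hq => D.contDiffAt_Ψ' hq,
    fun _ hp => D.Ψ_smul hp, fun _ hy => D.Ψ_boundary hy⟩

end CoreData

end HomothetyCover

end Summit.SmoothPoincare4.SmoothPoincare4.Theorems

end
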